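import Summits.SmoothPoincare4.SmoothPoincare4.Theses.VerlindeRLinks
import Literature.Topology.FourManifolds.HandleAttachingMapOfTube
import Literature.Topology.FourManifolds.HandleTubeDepthField
import Literature.Topology.FourManifolds.ClosedBallCollarProofs
import Literature.Topology.FourManifolds.DehnSurgery
import Literature.Topology.FourManifolds.LinkTubularUniqueness

/-!
# Line `kirby-lemma21`, Stub 1b (`stub_attachingMap_of_tube`): the radial attaching map of a tube
(crux `VerlindeRLinks.VrlComponentsHBallSlice`, item stmt-SmoothPoincare4-15874)

This file proves the registered stub `stub_attachingMap_of_tube` (signature verbatim from the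
skeleton `Cruxes/VrlComponentsHBallSlice/Lines/kirby_lemma21.lean`): every oriented tubular
neighbourhood `ν : S¹ × ℝ² ↪ S³` of a knot gives a Kosinski attaching map `g : T → D⁴` of a
`2`-handle on the `4`-disc (`HandleAttachingMap 3 2 (𝔻 4)`) with underlying map the RADIAL formula
`g y = (1 - depth(y)/4) · ν (angle y, fibre y)` (tube coordinates of `HandleAttachingMapOfTube.lean`).

Proof: a transcription of the tree's `TubeAttachData` construction (`HandleAttachingMapOfTube.lean`;
Kosinski, *Differential Manifolds* (1993), III §4 and VI §6) to `D⁴` with `∂D⁴ = S³` and the radial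
collar `c = closedBallCollarMap 3`, `c (x, t) = (1 - t/2) • x` (a smooth embedding `S³ × [0, 1] ↪ D⁴`,
discharged `isSmoothEmbedding_closedBallCollarMap_holds`; open below height `1`,
`image_mem_nhds_collar`), tube `ν` (an open smooth embedding with smooth inverse `ν.toHomeo.symm`,
`LinkTubularUniqueness.lean`), radius `κ = 1`, height `δ = 1/2`:
`g y = c (ν (angle y, fibre y), depth(y)/2)`.  As in the template, `g = c ∘ L` is smooth,
injective and open (the lift `L : T → S³ × [0, 1]` is a homeomorphism onto the open set `R`, with the
explicit smooth inverse `G (p, t) = depthLine θ w (2t)`, `(θ, w) = ν⁻¹ p`), its inverse is smooth by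
descent along the collar (`contMDiffAt_of_comp_isImmersionAt_of_nhds`), so it is a smooth embedding
(`isSmoothEmbedding_of_contMDiffOn_symm`), and at depth `0` it is the boundary inclusion of `ν`.
No definitions are introduced: the lift `L`, its inverse `G` and its range `R` are variables pinned
by the defining equations `h` (hypothesis of the intermediate lemmas, discharged by `rfl` at the end).

References: A. A. Kosinski, *Differential Manifolds* (1993), III §4, VI §1, VI §6; M. W. Hirsch,
*Differential Topology* (1976), §4.6; R. C. Kirby, *The Topology of 4-Manifolds* (1989), Ch. I §2.
-/

noncomputable section

-- the prescribed namespace `Summit.<P>.<Sub>.…` duplicates `SmoothPoincare4` (P = Sub)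
set_option linter.dupNamespace false

open scoped Manifold ContDiff Topology
open Set Function Metric Topology
open Literature.Topology.FourManifolds

namespace Summit.SmoothPoincare4.SmoothPoincare4.Theorems.VrlComponentsHBallSlice.KirbyLemma21

/-! ### The height `depth / 2` -/

/-- The height `(1 - ‖x‖²)/2` of a tube point lies in `[0, 1]`. [folklore] -/
theorem half_tubeDepth_mem_Icc (y : handleTube 3 2) : tubeDepth y / 2 ∈ Icc (0 : ℝ) 1 := by
  have h0 := tubeDepth_nonneg y
  have h1 := tubeDepth_lt_one y
  constructor <;> linarith

/-- The height of the lift is `(1 - ‖x‖²)/2`. [folklore] -/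
theorem coe_projIcc_half_tubeDepth (y : handleTube 3 2) :
    ((projIcc (0 : ℝ) 1 zero_le_one (tubeDepth y / 2) : Icc (0 : ℝ) 1) : ℝ) = tubeDepth y / 2 := by
  rw [projIcc_of_mem _ (half_tubeDepth_mem_Icc y)]

/-- The height of the lift is `< 1/2` (hence `< 1`). [folklore] -/
theorem projIcc_half_tubeDepth_lt_half (y : handleTube 3 2) :
    ((projIcc (0 : ℝ) 1 zero_le_one (tubeDepth y / 2) : Icc (0 : ℝ) 1) : ℝ) < 1 / 2 := by
  rw [coe_projIcc_half_tubeDepth]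
  have := tubeDepth_lt_one y
  linarith

/-- On the boundary sphere `T ∩ ∂D⁴` the height vanishes. [folklore] -/
theorem projIcc_half_tubeDepth_eq_bot {y : handleTube 3 2} (hy : ‖tubeVec y‖ = 1) :
    projIcc (0 : ℝ) 1 zero_le_one (tubeDepth y / 2) = ⊥ := by
  apply Subtype.ext
  rw [coe_projIcc_half_tubeDepth, (tubeDepth_eq_zero_iff y).2 hy, zero_div]
  rfl

/-! ### The radial collar of `∂D⁴` -/

/-- **The radial collar `(x, t) ↦ (1 - t/2) • x` is a smooth embedding `S³ × [0, 1] ↪ D⁴`** for the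
product model with corners (the discharged named fact `isSmoothEmbedding_closedBallCollarMap` at
`n = 2`, read at `3 = 2 + 1`). [cite: Hirsch1976, §4.6] -/
theorem isSmoothEmbedding_collar :
    Manifold.IsSmoothEmbedding ((𝓡 3).prod (𝓡∂ 1)) (𝓡∂ 4) ∞
      (closedBallCollarMap 3 : (sphere (0 : EuclideanSpace ℝ (Fin (3 + 1))) 1) × (Icc (0 : ℝ) 1) →
        closedBall (0 : EuclideanSpace ℝ (Fin 4)) 1) :=
  isSmoothEmbedding_closedBallCollarMap_holds 2

/-- The radial collar is open below the top: it maps neighbourhoods of `q = (x, s)`, `s < 1`, to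
neighbourhoods of `c q` in `D⁴` (transcription of `BoundaryData.Collar.image_mem_nhds`). [folklore] -/
theorem image_mem_nhds_collar {q : (sphere (0 : EuclideanSpace ℝ (Fin (3 + 1))) 1) × (Icc (0 : ℝ) 1)}
    (hq : (q.2 : ℝ) < 1) {U : Set ((sphere (0 : EuclideanSpace ℝ (Fin (3 + 1))) 1) × (Icc (0 : ℝ) 1))}
    (hU : U ∈ 𝓝 q) : closedBallCollarMap 3 '' U ∈ 𝓝 (closedBallCollarMap 3 q) := by
  obtain ⟨O, hOU, hO, hqO⟩ := _root_.mem_nhds_iff.1 (Filter.inter_mem hU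
    ((isOpen_lt (continuous_subtype_val.comp continuous_snd) continuous_const).mem_nhds hq))
  -- `c '' O` is open in `D⁴`
  obtain ⟨O', hO', hOO'⟩ := isSmoothEmbedding_collar.isEmbedding.isInducing.isOpen_iff.1 hO
  have himg : closedBallCollarMap 3 '' O = O' ∩ closedBallCollarMap 3 '' {p | (p.2 : ℝ) < 1} := by
    apply Subset.antisymm
    · rintro _ ⟨p, hp, rfl⟩
      refine ⟨?_, p, (hOU hp).2, rfl⟩
      have : p ∈ closedBallCollarMap 3 ⁻¹' O' := by rw [hOO']; exact hp
      exact this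
    · rintro y ⟨hy, p, hp, rfl⟩
      exact ⟨p, by rw [← hOO']; exact hy, rfl⟩
  refine Filter.mem_of_superset ((hO'.inter (isOpen_image_closedBallCollarMap 3)).mem_nhds ?_) ?_
  · rw [← himg]; exact mem_image_of_mem _ hqO
  · rw [← himg]; exact image_mono fun p hp => (hOU hp).1

/-- The radial collar maps open sets below height `1` to open sets (transcription of
`BoundaryData.Collar.isOpen_image_of_forall_lt_one`). [folklore] -/
theorem isOpen_image_collar {U : Set ((sphere (0 : EuclideanSpace ℝ (Fin (3 + 1))) 1) × (Icc (0 : ℝ) 1))}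
    (hU : IsOpen U) (h1 : ∀ q ∈ U, (q.2 : ℝ) < 1) : IsOpen (closedBallCollarMap 3 '' U) := by
  rw [isOpen_iff_mem_nhds]
  rintro _ ⟨q, hq, rfl⟩
  exact image_mem_nhds_collar (h1 q hq) (hU.mem_nhds hq)

/-! ### The lift `L`, its inverse `G` and its range `R` -/

variable {K : sphere (0 : EuclideanSpace ℝ (Fin (1 + 1))) 1 → sphere (0 : EuclideanSpace ℝ (Fin (3 + 1))) 1}
  (ν : Knot.TubularNbhd K)
  {L : handleTube 3 2 → (sphere (0 : EuclideanSpace ℝ (Fin (3 + 1))) 1) × (Icc (0 : ℝ) 1)}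
  {G : (sphere (0 : EuclideanSpace ℝ (Fin (3 + 1))) 1) × (Icc (0 : ℝ) 1) → handleTube 3 2}
  {R : Set ((sphere (0 : EuclideanSpace ℝ (Fin (3 + 1))) 1) × (Icc (0 : ℝ) 1))}
  /- The defining equations of the three pieces of the construction: the lift
  `L y = (ν (x_λ/|x_λ|, x_μ), (1 - ‖x‖²)/2)`, its inverse `G (p, t) = depthLine θ w (2t)`
  (`(θ, w) = ν⁻¹ p`: the point of `T` with angle `θ`, fibre `w` and depth `2t`), and its range `R`
  (cylinder points over `range ν`, of height `< 1/2`, with positive recovered `λ`-radius). -/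
  (h : (L = fun y => (ν (tubeAngle y, tubeFibre y), projIcc (0 : ℝ) 1 zero_le_one (tubeDepth y / 2))) ∧
    (G = fun q => depthLine (ν.toHomeo.symm q.1).1 (ν.toHomeo.symm q.1).2 (2 * (q.2 : ℝ))) ∧
    R = {q | q.1 ∈ range ν ∧ (q.2 : ℝ) < 1 / 2 ∧
      0 < 1 - 2 * (q.2 : ℝ) - ‖(ν.toHomeo.symm q.1).2‖ ^ 2})

include h

/-- **The lift `T → S³ × [0, 1]` is smooth** (`T` as an open submanifold of `D⁴`, the cylinder
with the product model with corners). [folklore] -/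
theorem contMDiff_lift : ContMDiff (𝓡∂ 4) ((𝓡 3).prod (𝓡∂ 1)) ∞ L := by
  obtain ⟨rfl, -, -⟩ := h
  have h1 : ContMDiff (𝓡∂ 4) (𝓡 3) ∞ fun y : handleTube 3 2 => ν (tubeAngle y, tubeFibre y) :=
    ν.contMDiff.comp (contMDiff_tubeAngle.prodMk contMDiff_tubeFibre)
  have h2 : ContMDiff (𝓡∂ 4) 𝓘(ℝ, ℝ) ∞ fun y : handleTube 3 2 => tubeDepth y / 2 :=
    (contDiff_id.div_const (2 : ℝ)).contMDiff.comp contMDiff_tubeDepth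
  exact h1.prodMk (contMDiffOn_projIcc.comp_contMDiff h2 fun y => half_tubeDepth_mem_Icc y)

/-- The attaching map `c ∘ L` is smooth. [folklore] -/
theorem contMDiff_amap : ContMDiff (𝓡∂ 4) (𝓡∂ 4) ∞ (closedBallCollarMap 3 ∘ L) :=
  isSmoothEmbedding_collar.contMDiff.comp (contMDiff_lift ν h)

/-- The lift lands in `R`: the recovered `λ`-radius of `L y` is `|x_λ|² > 0`. [folklore] -/
theorem lift_mem (y : handleTube 3 2) : L y ∈ R := by
  obtain ⟨rfl, -, rfl⟩ := h
  refine ⟨mem_range_self _, projIcc_half_tubeDepth_lt_half y, ?_⟩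
  show 0 < 1 - 2 * ((projIcc (0 : ℝ) 1 zero_le_one (tubeDepth y / 2) : Icc (0 : ℝ) 1) : ℝ) -
    ‖(ν.toHomeo.symm (ν (tubeAngle y, tubeFibre y))).2‖ ^ 2
  rw [ν.toHomeo_symm_apply, coe_projIcc_half_tubeDepth,
    show (1 : ℝ) - 2 * (tubeDepth y / 2) = 1 - tubeDepth y by ring, ← norm_lamPart_sq_eq]
  exact pow_pos (norm_lamPart_tubeVec_pos y) 2

/-- `G ∘ L = id` (`depthLine_tube`). [folklore] -/
theorem G_L (y : handleTube 3 2) : G (L y) = y := by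
  obtain ⟨rfl, rfl, -⟩ := h
  show depthLine (ν.toHomeo.symm (ν (tubeAngle y, tubeFibre y))).1
    (ν.toHomeo.symm (ν (tubeAngle y, tubeFibre y))).2
    (2 * ((projIcc (0 : ℝ) 1 zero_le_one (tubeDepth y / 2) : Icc (0 : ℝ) 1) : ℝ)) = y
  rw [ν.toHomeo_symm_apply, coe_projIcc_half_tubeDepth,
    show 2 * (tubeDepth y / 2) = tubeDepth y by ring]
  exact depthLine_tube y

/-- `L ∘ G = id` on `R`. [folklore] -/
theorem L_G {q : (sphere (0 : EuclideanSpace ℝ (Fin (3 + 1))) 1) × (Icc (0 : ℝ) 1)} (hq : q ∈ R) :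
    L (G q) = q := by
  obtain ⟨rfl, rfl, rfl⟩ := h
  obtain ⟨hp, -, hpos⟩ := hq
  have ht0 : (0 : ℝ) ≤ 2 * (q.2 : ℝ) := mul_nonneg zero_le_two q.2.2.1
  beta_reduce
  rw [tubeAngle_depthLine _ _ ht0 hpos, tubeFibre_depthLine _ _ ht0 hpos,
    tubeDepth_depthLine _ _ ht0 hpos, Prod.mk.eta, ν.apply_toHomeo_symm hp]
  refine Prod.ext rfl (Subtype.ext ?_)
  show ((projIcc (0 : ℝ) 1 zero_le_one (2 * (q.2 : ℝ) / 2) : Icc (0 : ℝ) 1) : ℝ) = q.2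
  rw [show 2 * (q.2 : ℝ) / 2 = q.2 by ring, projIcc_val]

/-- The underlying vector of `G q` is `mkVec θ w (2t)`, for `q ∈ R`. [folklore] -/
theorem tubeVec_G {q : (sphere (0 : EuclideanSpace ℝ (Fin (3 + 1))) 1) × (Icc (0 : ℝ) 1)}
    (hq : q ∈ R) :
    tubeVec (G q) =
      mkVec ((ν.toHomeo.symm q.1).1 : EuclideanSpace ℝ (Fin 2)) (ν.toHomeo.symm q.1).2
        (2 * (q.2 : ℝ)) := by
  obtain ⟨-, rfl, rfl⟩ := h
  exact tubeVec_depthLine _ _ (mul_nonneg zero_le_two q.2.2.1) hq.2.2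

/-- **The lift is injective** (it has the left inverse `G`). [folklore] -/
theorem injective_lift : Injective L := fun y y' hyy => by
  have h' := congrArg G hyy
  rwa [G_L ν h, G_L ν h] at h'

/-- **The range of the lift is `R`.** [folklore] -/
theorem range_lift : range L = R :=
  Subset.antisymm (range_subset_iff.2 (lift_mem ν h)) fun _ hq => ⟨_, L_G ν h hq⟩

/-! ### `R` is open and `G` is smooth on it -/

/-- **`R` is open.** [folklore] -/
theorem isOpen_R : IsOpen R := by
  obtain ⟨-, -, rfl⟩ := h
  have hS : IsOpen {q : (sphere (0 : EuclideanSpace ℝ (Fin (3 + 1))) 1) × (Icc (0 : ℝ) 1) |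
      q.1 ∈ range ν} :=
    ν.isOpenEmbedding.isOpen_range.preimage continuous_fst
  have h1 : Continuous fun q : (sphere (0 : EuclideanSpace ℝ (Fin (3 + 1))) 1) × (Icc (0 : ℝ) 1) =>
      (q.2 : ℝ) := continuous_subtype_val.comp continuous_snd
  have h2 : ContinuousOn (fun q : (sphere (0 : EuclideanSpace ℝ (Fin (3 + 1))) 1) × (Icc (0 : ℝ) 1) =>
      ‖(ν.toHomeo.symm q.1).2‖ ^ 2) {q | q.1 ∈ range ν} :=
    ((continuous_norm.comp continuous_snd).pow 2).comp_continuousOn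
      (ν.toHomeo.continuousOn_symm.comp continuous_fst.continuousOn fun _ hq => by
        rw [ν.toHomeo_target]; exact hq)
  have hg : ContinuousOn (fun q : (sphere (0 : EuclideanSpace ℝ (Fin (3 + 1))) 1) × (Icc (0 : ℝ) 1) =>
      ((q.2 : ℝ), 1 - 2 * (q.2 : ℝ) - ‖(ν.toHomeo.symm q.1).2‖ ^ 2)) {q | q.1 ∈ range ν} :=
    h1.continuousOn.prodMk ((continuousOn_const.sub (continuous_const.mul h1).continuousOn).sub h2)
  have h := hg.isOpen_inter_preimage hS
    ((isOpen_Iio (a := (1 / 2 : ℝ))).prod (isOpen_Ioi (a := (0 : ℝ))))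
  convert h using 1
  ext q
  simp only [mem_setOf_eq, mem_inter_iff, mem_preimage, mem_prod, mem_Iio, mem_Ioi]

/-- **`G` is smooth on `R`** (into the open submanifold `T` of `D⁴`: test in `ℝ⁴`, where it is the
smooth vector `mkVec θ w (2t)`, `contMDiffOn_mkVec`). [folklore] -/
theorem contMDiffOn_G : ContMDiffOn ((𝓡 3).prod (𝓡∂ 1)) (𝓡∂ 4) ∞ G R := by
  -- the recovered vector is smooth on `R`
  have hR : ∀ q ∈ R, q.1 ∈ range ν ∧ 0 < 1 - 2 * (q.2 : ℝ) - ‖(ν.toHomeo.symm q.1).2‖ ^ 2 := by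
    obtain ⟨-, -, rfl⟩ := h
    exact fun q hq => ⟨hq.1, hq.2.2⟩
  have hsymm : ContMDiffOn ((𝓡 3).prod (𝓡∂ 1)) ((𝓡 1).prod 𝓘(ℝ, EuclideanSpace ℝ (Fin 2))) ∞
      (fun q : (sphere (0 : EuclideanSpace ℝ (Fin (3 + 1))) 1) × (Icc (0 : ℝ) 1) =>
        ν.toHomeo.symm q.1) R :=
    ν.contMDiffOn_toHomeo_symm.comp contMDiffOn_fst fun q hq => (hR q hq).1
  have hV : ContMDiffOn ((𝓡 3).prod (𝓡∂ 1)) 𝓘(ℝ, EuclideanSpace ℝ (Fin 4)) ∞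
      (fun q : (sphere (0 : EuclideanSpace ℝ (Fin (3 + 1))) 1) × (Icc (0 : ℝ) 1) =>
        mkVec ((ν.toHomeo.symm q.1).1 : EuclideanSpace ℝ (Fin 2)) (ν.toHomeo.symm q.1).2
          (2 * (q.2 : ℝ))) R :=
    contMDiffOn_mkVec
      (((@contMDiff_coe_sphere _ _ _ _ 1 (fact_finrank_euclideanSpace_succ 1)).comp
        contMDiff_fst).comp_contMDiffOn hsymm)
      (contMDiff_snd.comp_contMDiffOn hsymm)
      ((contDiff_const.mul contDiff_id).contMDiff.comp
        (contMDiff_subtype_coe_Icc.comp contMDiff_snd)).contMDiffOn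
      fun q hq => (hR q hq).2
  -- hence `G`, tested in `ℝ⁴`
  intro q₀ hq₀
  apply ContMDiffAt.contMDiffWithinAt
  have hopen : R ∈ 𝓝 q₀ := (isOpen_R ν h).mem_nhds hq₀
  have hfs : ContMDiffAt ((𝓡 3).prod (𝓡∂ 1)) 𝓘(ℝ, EuclideanSpace ℝ (Fin 4)) ∞
      (fun q => tubeVec (G q)) q₀ :=
    ((hV q₀ hq₀).contMDiffAt hopen).congr_of_eventuallyEq (by
      filter_upwards [hopen] with q hq
      exact tubeVec_G ν h hq)
  have hmem : ∀ q, tubeVec (G q) ∈ closedBall (0 : EuclideanSpace ℝ (Fin 4)) 1 := fun q =>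
    ((G q : handleTube 3 2) : closedBall (0 : EuclideanSpace ℝ (Fin 4)) 1).2
  have h1 := hfs.codRestrict_closedBall hmem
  have h2 : codRestrict (fun q => tubeVec (G q)) (closedBall (0 : EuclideanSpace ℝ (Fin 4)) 1) hmem =
      Subtype.val ∘ G := by
    funext q; exact Subtype.ext rfl
  rw [h2] at h1
  exact (ContMDiffAt.subtypeVal_comp_iff (handleTube 3 2) G q₀).1 h1

/-! ### The attaching map is an open embedding with smooth inverse -/

/-- The lift maps open sets to open sets (a homeomorphism onto the open set `R`). [folklore] -/
theorem isOpen_image_lift {U : Set (handleTube 3 2)} (hU : IsOpen U) : IsOpen (L '' U) := by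
  have hU' : L '' U = R ∩ G ⁻¹' U := by
    ext q
    constructor
    · rintro ⟨y, hy, rfl⟩
      refine ⟨lift_mem ν h y, ?_⟩
      rw [mem_preimage, G_L ν h]
      exact hy
    · rintro ⟨hq, hqU⟩
      exact ⟨_, hqU, L_G ν h hq⟩
  rw [hU']
  exact (contMDiffOn_G ν h).continuousOn.isOpen_inter_preimage (isOpen_R ν h) hU

/-- **The attaching map is open** (the collar is open below height `1`). [folklore] -/
theorem isOpenMap_amap : IsOpenMap (closedBallCollarMap 3 ∘ L) := by
  intro U hU
  rw [image_comp]
  refine isOpen_image_collar (isOpen_image_lift ν h hU) ?_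
  rintro _ ⟨y, -, rfl⟩
  obtain ⟨rfl, -, -⟩ := h
  exact (projIcc_half_tubeDepth_lt_half y).trans one_half_lt_one

/-- The attaching map is an open topological embedding. [folklore] -/
theorem isOpenEmbedding_amap : IsOpenEmbedding (closedBallCollarMap 3 ∘ L) :=
  .of_continuous_injective_isOpenMap (contMDiff_amap ν h).continuous
    ((injective_closedBallCollarMap 3).comp (injective_lift ν h)) (isOpenMap_amap ν h)

/-- **The inverse of the attaching map is smooth on its range**, by descent along the collar:
near each point of `R`, `g⁻¹ ∘ c` is the smooth map `G`, and the collar is an immersion open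
at points of height `< 1` (Kosinski (1993), VI §1, proof of (1.1)). [cite: Kosinski1993, VI §1] -/
theorem contMDiffOn_symm_amap :
    ContMDiffOn (𝓡∂ 4) (𝓡∂ 4) ∞
      ((isOpenEmbedding_amap ν h).toOpenPartialHomeomorph (closedBallCollarMap 3 ∘ L)).symm
      (range (closedBallCollarMap 3 ∘ L)) := by
  rintro _ ⟨y, rfl⟩
  apply ContMDiffAt.contMDiffWithinAt
  set F := ((isOpenEmbedding_amap ν h).toOpenPartialHomeomorph (closedBallCollarMap 3 ∘ L)).symm
  have hopen : R ∈ 𝓝 (L y) := (isOpen_R ν h).mem_nhds (lift_mem ν h y)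
  have key : ContMDiffAt ((𝓡 3).prod (𝓡∂ 1)) (𝓡∂ 4) ∞ (fun q => F (closedBallCollarMap 3 q))
      (L y) := by
    refine (((contMDiffOn_G ν h) _ (lift_mem ν h y)).contMDiffAt hopen).congr_of_eventuallyEq ?_
    filter_upwards [hopen] with q hq
    obtain ⟨w, rfl⟩ : q ∈ range L := by rw [range_lift ν h]; exact hq
    rw [G_L ν h]
    exact (isOpenEmbedding_amap ν h).toOpenPartialHomeomorph_left_inv (f := closedBallCollarMap 3 ∘ L)
  have hlt : ((L y).2 : ℝ) < 1 := by
    obtain ⟨rfl, -, -⟩ := h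
    exact (projIcc_half_tubeDepth_lt_half y).trans one_half_lt_one
  change ContMDiffAt (𝓡∂ 4) (𝓡∂ 4) ∞ F (closedBallCollarMap 3 (L y))
  exact contMDiffAt_of_comp_isImmersionAt_of_nhds
    (isSmoothEmbedding_collar.isImmersion.isImmersionAt (L y))
    (fun U hU => image_mem_nhds_collar hlt hU) key fun _ => rfl

/-- **The attaching map is a smooth embedding `T → D⁴`** (`Manifold.IsSmoothEmbedding` for `𝓡∂ 4`
on both sides). [cite: Kosinski1993, III §4 and VI §6] -/
theorem isSmoothEmbedding_amap :
    Manifold.IsSmoothEmbedding (𝓡∂ 4) (𝓡∂ 4) ∞ (closedBallCollarMap 3 ∘ L) :=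
  isSmoothEmbedding_of_contMDiffOn_symm (isOpenEmbedding_amap ν h) (contMDiff_amap ν h)
    (contMDiffOn_symm_amap ν h)

/-- Points of the boundary sphere `T ∩ ∂D⁴` go to `∂D⁴`: there the height vanishes and the collar
is the boundary inclusion `closedBallCollarMap_apply_bot`. [cite: Kosinski1993, VI §6] -/
theorem amap_of_norm_eq_one {y : handleTube 3 2} (hy : ‖tubeVec y‖ = 1) :
    (closedBallCollarMap 3 ∘ L) y = (closedBallBoundaryData 3).incl (ν (tubeAngle y, tubeFibre y)) := by
  obtain ⟨rfl, -, -⟩ := h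
  rw [comp_apply, projIcc_half_tubeDepth_eq_bot hy]
  exact closedBallCollarMap_apply_bot 3 _

/-- **The radial formula**: as a vector of `ℝ⁴`,
`c (ν (angle y, fibre y), depth(y)/2) = (1 - depth(y)/4) • ν (angle y, fibre y)`. [folklore] -/
theorem coe_amap (y : handleTube 3 2) :
    (((closedBallCollarMap 3 ∘ L) y : closedBall (0 : EuclideanSpace ℝ (Fin 4)) 1) :
        EuclideanSpace ℝ (Fin 4)) =
      (1 - tubeDepth y / 4) •
        ((ν (tubeAngle y, tubeFibre y) : sphere (0 : EuclideanSpace ℝ (Fin (3 + 1))) 1) :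
          EuclideanSpace ℝ (Fin 4)) := by
  obtain ⟨rfl, -, -⟩ := h
  rw [comp_apply, coe_closedBallCollarMap, coe_projIcc_half_tubeDepth]
  congr 1
  ring

omit h

/-! ### The stub -/

/-- **Stub 1b of line `kirby-lemma21` — the radial attaching map of a tube**
(`stub_attachingMap_of_tube`, registered signature verbatim).  For every oriented tubular
neighbourhood `ν : S¹ × ℝ² ↪ S³` of a knot `K` there is a Kosinski attaching map `g : T → D⁴` of a
`2`-handle on the `4`-disc (`HandleAttachingMap 3 2 (𝔻 4)`: a smooth embedding of the tube
`T = {x ∈ D⁴ | x_λ ≠ 0}` with open range taking `T ∩ ∂D⁴` into `∂D⁴`) given by the RADIAL formula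
`g y = (1 - depth(y)/4) · ν (angle y, fibre y)` in the tube coordinates of
`HandleAttachingMapOfTube.lean` (`tubeAngle y = x_λ/|x_λ|`, `tubeFibre y = x_μ`,
`tubeDepth y = 1 - ‖x‖²`): Kosinski's `h̄ = c ∘ L` for the tube `ν` in `∂D⁴ = S³` prolonged
along the radial collar `c (x, t) = (1 - t/2) • x` at height `depth/2`.
[cite: Kosinski1993, III §4 and VI §6] -/
theorem stub_attachingMap_of_tube :
    ∀ (K : Knot) (ν : Knot.TubularNbhd ⇑K),
      ∃ g : HandleAttachingMap 3 2 (Metric.closedBall (0 : EuclideanSpace ℝ (Fin 4)) 1),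
        ∀ y : ↥(handleTube 3 2),
          ((g.toFun y : Metric.closedBall (0 : EuclideanSpace ℝ (Fin 4)) 1) : EuclideanSpace ℝ (Fin 4)) =
            (1 - tubeDepth y / 4) •
              ((ν (tubeAngle y, tubeFibre y) : Metric.sphere (0 : EuclideanSpace ℝ (Fin 4)) 1) :
                EuclideanSpace ℝ (Fin 4)) := by
  intro K ν
  have h := And.intro (Eq.refl fun y : handleTube 3 2 =>
      (ν (tubeAngle y, tubeFibre y), projIcc (0 : ℝ) 1 zero_le_one (tubeDepth y / 2)))
    (And.intro (Eq.refl fun q : (sphere (0 : EuclideanSpace ℝ (Fin (3 + 1))) 1) × (Icc (0 : ℝ) 1) =>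
      depthLine (ν.toHomeo.symm q.1).1 (ν.toHomeo.symm q.1).2 (2 * (q.2 : ℝ)))
      (Eq.refl {q : (sphere (0 : EuclideanSpace ℝ (Fin (3 + 1))) 1) × (Icc (0 : ℝ) 1) |
        q.1 ∈ range ν ∧ (q.2 : ℝ) < 1 / 2 ∧ 0 < 1 - 2 * (q.2 : ℝ) - ‖(ν.toHomeo.symm q.1).2‖ ^ 2}))
  refine ⟨⟨_, isSmoothEmbedding_amap ν h, (isOpenMap_amap ν h).isOpen_range, fun y hy => ?_⟩,
    fun y => coe_amap ν h y⟩
  show (𝓡∂ 4).IsBoundaryPoint ((closedBallCollarMap 3 ∘ _) y)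
  rw [amap_of_norm_eq_one ν h hy]
  exact (closedBallBoundaryData 3).incl_mem_boundary _

end Summit.SmoothPoincare4.SmoothPoincare4.Theorems.VrlComponentsHBallSlice.KirbyLemma21

end
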